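import Literature.MathematicalPhysics.KineticTheory.LangevinChainExpMartingale

/-!
# Pathwise kinematics of the Langevin-driven pinned chain: positions integrate momenta

Helper (`--supports`) for the line `contact-current-forgetting` of the crux `JunctionLocality.NonBallistic`
(stmt-AtomisticToContinuum-9127), stub `stub_lightConeWindow` (LC), missing fact (FS), piece (B) of the
assembly FS-A + FS-BC + FS-D: the deterministic position control along the pathwise flow
`z = (pinnedChain ω₂ lam β γ).chainFlow N x η` (`LangevinChainSDE.lean`) driven by a continuous
momentum-noise path `η`.

The forcing `x + (0, η t)` of the Langevin integral equation touches the MOMENTA only, and the position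
component of the drift is the momentum (`(drift z).1 = z.2`), so the position components of
`z(t) - x - (0, η t) = ∫₀ᵗ Y(z(s)) ds` (`pinnedChain_chainFlow_sub_sub_eq_integral`) read

  `q_i(s) = q_i(0) + ∫₀ˢ p_i(r) dr`,

whence, by Cauchy–Schwarz in time and monotonicity of `s ↦ ∫₀ˢ p_i²`,

  `q_i(s)² ≤ 2 q_i(0)² + 2 t ∫₀ᵗ p_i(r)² dr`     (`0 ≤ s ≤ t`).

* `sq_intervalIntegral_le_mul_intervalIntegral_sq` — `(∫₀ᵗ f)² ≤ t ∫₀ᵗ f²` (continuous `f`, `t ≥ 0`),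
  by nonnegativity of the quadratic `s ↦ ∫₀ᵗ (f - s)²` (no `L²` machinery);
* `pinnedChain_chainFlow_position_sq_le` (registered) — the two displays above, for `chainFlow`;
* `pinnedChain_solMap_position_sq_le` — the same for the solution map `solMap N T_L T_R r x w`
  driven by a pair of raw paths (`solMap_eq_chainFlow`).
-/

noncomputable section

open MeasureTheory Set Filter Topology intervalIntegral
open scoped NNReal

namespace Summit.AtomisticToContinuum.FouriersLaw.Theorems.NonBallistic

open Literature.MathematicalPhysics.KineticTheory Literature.MathematicalPhysics.KineticTheory.HeatConduction
open Literature.Probability.Process OscillatorChain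

/-- **Cauchy–Schwarz in time**: `(∫₀ᵗ f)² ≤ t ∫₀ᵗ f²` for a continuous `f` and `t ≥ 0` (the quadratic
`s ↦ ∫₀ᵗ (f(r) - s)² dr = t s² - 2 (∫₀ᵗ f) s + ∫₀ᵗ f²` is nonnegative, so its discriminant is `≤ 0`).
[folklore] -/
theorem sq_intervalIntegral_le_mul_intervalIntegral_sq {f : ℝ → ℝ} (hf : Continuous f) {t : ℝ}
    (ht : 0 ≤ t) : (∫ r in (0:ℝ)..t, f r) ^ 2 ≤ t * ∫ r in (0:ℝ)..t, f r ^ 2 := by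
  set I := ∫ r in (0:ℝ)..t, f r with hI
  set J := ∫ r in (0:ℝ)..t, f r ^ 2 with hJ
  have hfi : IntervalIntegrable f volume 0 t := hf.intervalIntegrable 0 t
  have hf2i : IntervalIntegrable (fun r => f r ^ 2) volume 0 t := (hf.pow 2).intervalIntegrable 0 t
  have hq : ∀ s : ℝ, 0 ≤ t * (s * s) + (-2 * I) * s + J := by
    intro s
    have h0 : 0 ≤ ∫ r in (0:ℝ)..t, (f r - s) ^ 2 :=
      intervalIntegral.integral_nonneg ht fun r _ => sq_nonneg _
    have he : ∫ r in (0:ℝ)..t, (f r - s) ^ 2 = J - 2 * s * I + (t - 0) * s ^ 2 := by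
      have e1 : (fun r => (f r - s) ^ 2) = fun r => (f r ^ 2 - (2 * s) * f r) + s ^ 2 := by
        funext r; ring
      rw [e1, intervalIntegral.integral_add (hf2i.sub (hfi.const_mul _)) intervalIntegrable_const,
        intervalIntegral.integral_sub hf2i (hfi.const_mul _), intervalIntegral.integral_const_mul,
        intervalIntegral.integral_const, smul_eq_mul]
    rw [he] at h0
    nlinarith [h0]
  have hd := discrim_le_zero hq
  rw [discrim] at hd
  nlinarith [hd]

/-- **Registered helper `pinnedChain_chainFlow_position_sq_le`** (piece (B) of (FS), line
`contact-current-forgetting`): along the pathwise flow of the pinned anharmonic chain driven by a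
continuous momentum-noise path, positions integrate momenta, `q_i(s) = q_i(0) + ∫₀ˢ p_i`, hence
`q_i(s)² ≤ 2 q_i(0)² + 2 t ∫₀ᵗ p_i²` for `0 ≤ s ≤ t`. [folklore] -/
theorem pinnedChain_chainFlow_position_sq_le :
    ∀ ω₂ lam β γ : ℝ, 0 < ω₂ → 0 ≤ lam → 0 ≤ β → 0 ≤ γ →
      ∀ (N : ℕ) (x : PhaseSpace N) (η : ℝ → Fin N → ℝ), Continuous η →
        ∀ (t : ℝ), ∀ s ∈ Set.Icc (0:ℝ) t, ∀ i : Fin N,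
          ((pinnedChain ω₂ lam β γ).chainFlow N x η s).1 i =
              x.1 i + ∫ r in (0:ℝ)..s, ((pinnedChain ω₂ lam β γ).chainFlow N x η r).2 i ∧
          ((pinnedChain ω₂ lam β γ).chainFlow N x η s).1 i ^ 2 ≤
              2 * x.1 i ^ 2 + 2 * t * ∫ r in (0:ℝ)..t, ((pinnedChain ω₂ lam β γ).chainFlow N x η r).2 i ^ 2 := by
  intro ω₂ lam β γ hω hl hβ hγ N x η hη t s hs i
  set z := (pinnedChain ω₂ lam β γ).chainFlow N x η with hz
  have hzc : Continuous z := pinnedChain_continuous_chainFlow hω hl hβ hγ N x hη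
  have hpc : Continuous fun r => (z r).2 i := (continuous_apply i).comp (continuous_snd.comp hzc)
  have ht : 0 ≤ t := hs.1.trans hs.2
  -- the position component of the integral equation
  have hq : (z s).1 i = x.1 i + ∫ r in (0:ℝ)..s, (z r).2 i := by
    have h := pinnedChain_chainFlow_sub_sub_eq_integral hω hl hβ hγ N x hη (T := t) hs
    have h1 := congrArg (fun w : PhaseSpace N => w.1 i) h
    simp only [Prod.fst_sub, Pi.sub_apply, Pi.zero_apply, sub_zero] at h1
    have hdc : Continuous fun r => (pinnedChain ω₂ lam β γ).drift N (z r) :=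
      (pinnedChain_contDiff_drift ω₂ lam β γ N (n := 0)).continuous.comp hzc
    set L : PhaseSpace N →L[ℝ] ℝ :=
      (ContinuousLinearMap.proj i).comp (ContinuousLinearMap.fst ℝ (Fin N → ℝ) (Fin N → ℝ)) with hL
    have h2 : (∫ r in (0:ℝ)..s, (pinnedChain ω₂ lam β γ).drift N (z r)).1 i = ∫ r in (0:ℝ)..s, (z r).2 i :=
      -- adapted from `integral_fst_apply` (OddSectorIrreversibilityOddCorrectorDecayVariationPathwise)
      calc (∫ r in (0:ℝ)..s, (pinnedChain ω₂ lam β γ).drift N (z r)).1 i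
          = L (∫ r in (0:ℝ)..s, (pinnedChain ω₂ lam β γ).drift N (z r)) := rfl
        _ = ∫ r in (0:ℝ)..s, L ((pinnedChain ω₂ lam β γ).drift N (z r)) :=
            (L.intervalIntegral_comp_comm (hdc.intervalIntegrable 0 s)).symm
        _ = ∫ r in (0:ℝ)..s, (z r).2 i := rfl
    rw [h2] at h1
    linarith
  refine ⟨hq, ?_⟩
  -- Cauchy–Schwarz in time and monotonicity in the upper limit
  have hcs := sq_intervalIntegral_le_mul_intervalIntegral_sq hpc hs.1
  have hmono : ∫ r in (0:ℝ)..s, (z r).2 i ^ 2 ≤ ∫ r in (0:ℝ)..t, (z r).2 i ^ 2 :=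
    intervalIntegral.integral_mono_interval le_rfl hs.1 hs.2 (Eventually.of_forall fun r => sq_nonneg _)
      ((hpc.pow 2).intervalIntegrable 0 t)
  have hJ0 : 0 ≤ ∫ r in (0:ℝ)..s, (z r).2 i ^ 2 :=
    intervalIntegral.integral_nonneg hs.1 fun r _ => sq_nonneg _
  have hsq : (x.1 i + ∫ r in (0:ℝ)..s, (z r).2 i) ^ 2 ≤
      2 * x.1 i ^ 2 + 2 * (∫ r in (0:ℝ)..s, (z r).2 i) ^ 2 := by
    nlinarith [sq_nonneg (x.1 i - ∫ r in (0:ℝ)..s, (z r).2 i)]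
  have hst : s * ∫ r in (0:ℝ)..s, (z r).2 i ^ 2 ≤ t * ∫ r in (0:ℝ)..t, (z r).2 i ^ 2 :=
    mul_le_mul hs.2 hmono hJ0 ht
  rw [hq]
  linarith

/-- The same for the solution map `Φ_r(x, w) = chainFlow x (pairNoise w) r` of the chain driven by a pair
of raw paths with bath temperatures `T_L, T_R` (`solMap_eq_chainFlow`): for `0 ≤ s ≤ t`,
`qᵢ(Φ_s(x,w))² ≤ 2 qᵢ(x)² + 2 t ∫₀ᵗ pᵢ(Φ_r(x,w))² dr`. [folklore] -/
theorem pinnedChain_solMap_position_sq_le :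
    ∀ ω₂ lam β γ : ℝ, 0 < ω₂ → 0 ≤ lam → 0 ≤ β → 0 ≤ γ →
      ∀ (N : ℕ) (T_L T_R : ℝ) (x : PhaseSpace N) (w : WienerPair) (t : ℝ), ∀ s ∈ Set.Icc (0:ℝ) t,
        ∀ i : Fin N,
          ((pinnedChain ω₂ lam β γ).solMap N T_L T_R s x w).1 i ^ 2 ≤
            2 * x.1 i ^ 2 +
              2 * t * ∫ r in (0:ℝ)..t, ((pinnedChain ω₂ lam β γ).solMap N T_L T_R r x w).2 i ^ 2 := by
  intro ω₂ lam β γ hω hl hβ hγ N T_L T_R x w t s hs i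
  simp only [solMap_eq_chainFlow]
  exact (pinnedChain_chainFlow_position_sq_le ω₂ lam β γ hω hl hβ hγ N x _
    ((pinnedChain ω₂ lam β γ).continuous_pairNoise N T_L T_R w) t s hs i).2

end Summit.AtomisticToContinuum.FouriersLaw.Theorems.NonBallistic

end
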